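import Summits.QuantumFields.YangMills.Theorems.UnitScaleTiltProp7AccumulatedFrameStep
import Summits.QuantumFields.YangMills.Theorems.UnitScaleTiltProp8ChartDiff
import Summits.QuantumFields.YangMills.Theorems.UnitScaleTiltProp7SymAvgTwSymDefs
import Literature.MathematicalPhysics.QuantumFieldTheory.Balaban1983to89.BlockAveragingEMLAnalyticMean
import HarnessLib

/-!
# Route `UnitScaleTilt`, crux K1 «MinimiserStabilityRegPr» (stmt-QuantumFields-19200), route-R E′ (A′)-on-Σ, P-A2-COMB (β), item «R0-RECURSION» (★★OWNER RULING №19; px13 g6's pen,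
# architecture R0-DOOR `(R0) ⟸ Φᶜ + Φˢ + REM2ˢ + REM2ᶜ`), sub-brick R0-LIN-S — THE LINEAR RESPONSE OF THE SYMMETRIC ACCUMULATED FRAMES, LEVEL BY LEVEL:
# `D v_{k+1}(y) = |Idx|⁻¹ Σ_i ( D R_{k,i}(y) + ν_i · D v_k(x_i) · ν_i⁻¹ )` — the centre frame cancels EXACTLY at first order — and, at the top, `D(frameTwS W · y)(0) = D v_{K−n}(siteShift y)(0)`

Cell `ym3-torus`, twin-width seat `ym-routeR-w2` (gen 9); px13 g6 05:30:28Z «R0-LIN: GO, ABSTRACT-ℓ FORM, ONE TOWER AT A TIME».  THEOREMS ONLY (0 `def`, 0 `sorry`);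
`--supports stmt-QuantumFields-19200 --as helper`, count-neutral.  YM₃ on T³ is a ladder rung (R3), not the Clay problem; nothing here claims the stub, the crux, (β), `hPA2`, `hcoS`, d = 4
or the mass gap.

THE POINT.  px13 g6's one-tower second-order recursion for REM2ˢ = `Σ_y ‖↑(frameTwS W A y) − 1 − fderiv ℂ (A ↦ ↑(frameTwS W A y)) 0 A‖` (R0-DOOR `Prop7R0OfFrameRows.siteRow_of_frameRows`, row
`hrs`) runs on ✓`Prop7SymAvgTwSym.frameAccU_succ` — (97) `v_{k+1}(y) = v_k(emb y)·w_k(y)`, `w_k(y) = eml_i tstair_i(y)` — read through the plain tower by ✓px22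
`Prop7AccumulatedFrameStep.tstairU_eq_frame_inv_mul`: `tstair_i(y) = v_k(emb y)⁻¹ · R_{k,i}(y) · a_{k,i}(y)`, `R_{k,i} = Ū⁽ᵏ⁾(st_i)·Ū₀⁽ᵏ⁾(st_i)⁻¹` the single-bar stair ratio,
`a_{k,i} = ν_i · v_k(x_i) · ν_i⁻¹` the conjugated frame at the stair's end (`ν_i = Ū₀⁽ᵏ⁾(st_i)`, `x_i = emb y + disp st_i`), with ARBITRARY linear parts `ℓ` subtracted (✓px22
`mul_eml_sub_one_eq`, px13 `mul_sub_one_sub_add_eq`) and the abstract recursion `ℓ_{k+1}(y) := |Idx|⁻¹ Σ_i (ℓR_{k,i}(y) + ν_i ℓ_k(x_i) ν_i⁻¹)`.  For its top line to land on `hrs` the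
abstract `ℓ` must be THE derivative.  This file proves that THE Fréchet derivatives satisfy exactly that recursion (so uniqueness of `fderiv` pins px13's `ℓ` level by level), for an
arbitrary differentiable perturbation FAMILY `W : E → GaugeField P 0 𝔸ˣ` through the background (`W a = V₀`), in any complete normed ℂ-algebra:
* §1 (calculus at a base point where every factor is `1`): `hasFDerivAt_coe_inv_of_eq_one` (`−u′`), `hasFDerivAt_coe_inv_mul_of_eq_one` (`v′ − u′`), `hasFDerivAt_mul_of_eq_one` (`u′ + v′`),
  `hasFDerivAt_conj` (`Ad_ν ∘ f′`), ★★ `hasFDerivAt_mul_eml_inv_mul_of_eq_one` — `D[v · eml_i(v⁻¹ · b_i)](a) = |ι|⁻¹ Σ_i b′_i` when `v a = b_i a = 1` (lit ✓`hasFDerivAt_eml_one`: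
  `D eml(1) = meanCLM`) — the LINEAR twin of ✓px22 `mul_eml_sub_one_eq`: the centre frame drops out.
* §2 (the symmetric tower, generic `Params`∕`𝔸`): `hasFDerivAt_coe_frameAccU_zero` (`v_0 ≡ 1`, derivative `0`); ★★★ `hasFDerivAt_coe_frameAccU_succ` — given the derivatives `ρ i` of the
  stair ratios `t ↦ ↑(R_{k,i}(t))`, `ℓ i` of `t ↦ ↑(v_k(t)(x_i))` and `ℓ₀` of `t ↦ ↑(v_k(t)(emb y))`, the accumulated frame `t ↦ ↑(v_{k+1}(t)(y))` has derivative
  `|Idx|⁻¹ Σ_i (ρ i + Ad_{ν_i} ∘ ℓ i)` (no `ℓ₀`!); ★★ `hasFDerivAt_coe_vframeCovU_succ` — the ONE-STEP frame `t ↦ ↑(w_k(t)(y))` has derivative `|Idx|⁻¹ Σ_i (ρ i + Ad_{ν_i} ∘ ℓ i) − ℓ₀`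
  and value `1` at `a` (px13's (i)); ★★ `fderiv_coe_frameAccU_succ` — the `fderiv` form = px13's `ℓ`-recursion for `ℓ := fderiv`; `differentiableAt_stairRatio` — the stair ratios are
  differentiable as soon as the plain tower's bonds are (✓`Prop8Chart.differentiableAt_coe_holT`).
* §3 (the member): `frameTwS_family_eq` ∕ ★ `fderiv_frameTwS_eq_fderiv_frameAccU` — `fderiv ℂ (A ↦ ↑(frameTwS F n K h W A y)) 0` IS the derivative at `0` of the family
  `A ↦ ↑(frameAccU (K − n) U₀♭ (e^{A}·U₀♭) (siteShift y))` (✓`frameTwS_def`), whose base point is `e^{0}·U₀♭ = U₀♭` (`family_zero`) — px13's (ii): the top of the recursion lands on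
  R0-DOOR's `hrs` letters by `rw`.
HONEST SCOPE.  Calculus and bookkeeping; differentiability of the plain tower ∕ of the accumulated frames enters as DISPLAYED hypotheses (at the member they follow from
✓`Prop7SymFrameBound.analyticAt_coe_frameAccU_of_plaqSmall` ∕ ✓`Prop7SymAvgRelativeDiff.differentiableAt_coe_emlIterU_family_of_reads` under the (β) lane's windows — not re-derived
here); NO second-order term, no smallness, no currency; nothing of print asserted; (R0), REM2ˢ, (β), `hD`, `hPA2`, `hcoS`, the stub and the crux are NOT advanced analytically by this file.
The comb twin (R0-LIN-C, on lit `vcov_succ` ∕ ★routeR-w6 F1 `coe_vcov_succ_eq`) is a separate file.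

References: T. Bałaban, CMP 98 (1985) 17–51 [Balaban1985Averaging] ((58) p.27, (82) p.30, (89) p.31, (97) p.32); CMP 109 (1987) 249–301 [Balaban1987RG1] ((0.4) p.253, (0.8) p.254);
CMP 99 (1985) 389–434 [Balaban1985BackgroundPropagators] ((3.14) p.393).
-/

set_option autoImplicit false

noncomputable section

open scoped Matrix.Norms.L2Operator BigOperators

namespace Summit.QuantumFields.YangMills.Theorems.Prop7SymFrameLinearResponseStep

open NormedSpace
open Literature.MathematicalPhysics.QuantumFieldTheory.Balaban1983to89
open T4Continuum BlockAveraging ExpMeanLog MatrixLog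
open B7TransferAnalyticMean (meanCLM meanCLM_apply)
open BlockAveragingEMLAnalyticMean (hasFDerivAt_eml_one eml_one)

/-! ## §1 Calculus at a base point where every factor is `1` -/

section Calculus

variable {𝕜 : Type*} [NontriviallyNormedField 𝕜] {E : Type*} [NormedAddCommGroup E] [NormedSpace 𝕜 E]
  {𝔸 : Type*} [NormedRing 𝔸] [NormedAlgebra 𝕜 𝔸] [CompleteSpace 𝔸]

/-- **THE INVERSE AT `1`**: if `x ↦ ↑(u x)` has derivative `u′` at `a` and `u a = 1`, then `x ↦ ↑(u x)⁻¹` has derivative `−u′` (Mathlib `hasFDerivAt_ringInverse`). [folklore] -/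
theorem hasFDerivAt_coe_inv_of_eq_one {u : E → 𝔸ˣ} {u' : E →L[𝕜] 𝔸} {a : E}
    (hu : HasFDerivAt (fun x => (u x : 𝔸)) u' a) (h1 : u a = 1) :
    HasFDerivAt (fun x => (((u x)⁻¹ : 𝔸ˣ) : 𝔸)) (-u') a := by
  have hinv : HasFDerivAt (Ring.inverse : 𝔸 → 𝔸)
      (-ContinuousLinearMap.mulLeftRight 𝕜 𝔸 ((u a)⁻¹ : 𝔸ˣ) ((u a)⁻¹ : 𝔸ˣ)) (u a : 𝔸) :=
    hasFDerivAt_ringInverse (u a)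
  have hcomp := hinv.comp a hu
  have heq : (fun x => (((u x)⁻¹ : 𝔸ˣ) : 𝔸)) = Ring.inverse ∘ fun x => (u x : 𝔸) := by
    funext x; simp [Function.comp]
  rw [heq]
  refine hcomp.congr_fderiv ?_
  ext v
  simp [h1]

/-- **`u⁻¹·v` AT `u = v = 1`**: derivative `v′ − u′`. [folklore] -/
theorem hasFDerivAt_coe_inv_mul_of_eq_one {u v : E → 𝔸ˣ} {u' v' : E →L[𝕜] 𝔸} {a : E}
    (hu : HasFDerivAt (fun x => (u x : 𝔸)) u' a) (hv : HasFDerivAt (fun x => (v x : 𝔸)) v' a)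
    (hu1 : u a = 1) (hv1 : v a = 1) :
    HasFDerivAt (fun x => (((u x)⁻¹ * v x : 𝔸ˣ) : 𝔸)) (v' - u') a := by
  have hd := (hasFDerivAt_coe_inv_of_eq_one hu hu1).mul' hv
  have heq : (fun x => (((u x)⁻¹ * v x : 𝔸ˣ) : 𝔸)) = fun x => (((u x)⁻¹ : 𝔸ˣ) : 𝔸) * (v x : 𝔸) := by
    funext x; simp
  rw [heq]
  refine hd.congr_fderiv ?_
  ext z
  simp [hu1, hv1]
  abel

omit [CompleteSpace 𝔸] in
/-- **`u·v` AT `u = v = 1`** (plain `𝔸`-valued factors): derivative `u′ + v′`. [folklore] -/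
theorem hasFDerivAt_mul_of_eq_one {u v : E → 𝔸} {u' v' : E →L[𝕜] 𝔸} {a : E}
    (hu : HasFDerivAt u u' a) (hv : HasFDerivAt v v' a) (hu1 : u a = 1) (hv1 : v a = 1) :
    HasFDerivAt (fun x => u x * v x) (u' + v') a := by
  refine (hu.mul' hv).congr_fderiv ?_
  ext z
  simp [hu1, hv1, add_comm]

omit [CompleteSpace 𝔸] in
/-- **CONJUGATION BY CONSTANTS IS LINEAR**: `D[c · f · d] = (z ↦ c · f′ z · d)` (`ContinuousLinearMap.mulLeftRight`). [folklore] -/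
theorem hasFDerivAt_conj {f : E → 𝔸} {f' : E →L[𝕜] 𝔸} {a : E} (hf : HasFDerivAt f f' a) (c d : 𝔸) :
    HasFDerivAt (fun x => c * f x * d) ((ContinuousLinearMap.mulLeftRight 𝕜 𝔸 c d).comp f') a := by
  refine (((hasFDerivAt_const c a).mul' hf).mul' (hasFDerivAt_const d a)).congr_fderiv ?_
  ext z
  simp

end Calculus

section Eml

variable {E : Type*} [NormedAddCommGroup E] [NormedSpace ℂ E]
  {𝔸 : Type*} [NormedRing 𝔸] [NormedAlgebra ℂ 𝔸] [CompleteSpace 𝔸] {ι : Type*} [Fintype ι] [Nonempty ι]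

/-- ★★ **THE CENTRE FRAME CANCELS EXACTLY AT FIRST ORDER — LINEAR TWIN OF ✓px22 `mul_eml_sub_one_eq`**: for a unit-valued `v` and a family `b_i`, all `= 1` at `a` and differentiable there,
`D[v · eml_i(v⁻¹ · b_i)](a) = |ι|⁻¹ Σ_i b′_i` (`D eml(1) = meanCLM`, lit ✓`hasFDerivAt_eml_one`; the `v′` of the prefactor and the `−v′` inside the mean cancel).
[cite: Balaban1985Averaging, (97) p.32, (82) p.30; Balaban1987RG1, (0.8) p.254] -/
theorem hasFDerivAt_mul_eml_inv_mul_of_eq_one {v : E → 𝔸ˣ} {b : ι → E → 𝔸} {v' : E →L[ℂ] 𝔸} {b' : ι → E →L[ℂ] 𝔸} {a : E}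
    (hv : HasFDerivAt (fun x => (v x : 𝔸)) v' a) (hb : ∀ i, HasFDerivAt (b i) (b' i) a) (hv1 : v a = 1) (hb1 : ∀ i, b i a = 1) :
    HasFDerivAt (fun x => (v x : 𝔸) * eml (fun i => (((v x)⁻¹ : 𝔸ˣ) : 𝔸) * b i x)) ((Fintype.card ι : ℂ)⁻¹ • ∑ i, b' i) a := by
  -- the inner tuple `G x := (v x)⁻¹ · b_i x` has derivative `(b′_i − v′)_i` and value `1`
  have hG : HasFDerivAt (fun x => fun i => (((v x)⁻¹ : 𝔸ˣ) : 𝔸) * b i x) (ContinuousLinearMap.pi fun i => b' i - v') a := by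
    apply hasFDerivAt_pi.2
    intro i
    have h := ((hasFDerivAt_coe_inv_of_eq_one hv hv1).mul' (hb i))
    refine h.congr_fderiv ?_
    ext z
    simp [hv1, hb1 i]
    abel
  have hG1 : (fun i => (((v a)⁻¹ : 𝔸ˣ) : 𝔸) * b i a) = (1 : ι → 𝔸) := by
    funext i; rw [hv1, hb1 i, inv_one, Units.val_one, one_mul]; rfl
  have heml : HasFDerivAt (eml : (ι → 𝔸) → 𝔸) (meanCLM ι 𝔸) ((fun x => fun i => (((v x)⁻¹ : 𝔸ˣ) : 𝔸) * b i x) a) := by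
    rw [show ((fun x => fun i => (((v x)⁻¹ : 𝔸ˣ) : 𝔸) * b i x) a) = (1 : ι → 𝔸) from hG1]
    exact hasFDerivAt_eml_one
  have hcomp : HasFDerivAt (fun x => eml (fun i => (((v x)⁻¹ : 𝔸ˣ) : 𝔸) * b i x)) ((meanCLM ι 𝔸).comp (ContinuousLinearMap.pi fun i => b' i - v')) a :=
    heml.comp a hG
  have hval : eml (fun i => (((v a)⁻¹ : 𝔸ˣ) : 𝔸) * b i a) = 1 := by rw [hG1, eml_one]
  have hprod := hv.mul' hcomp
  rw [hval, hv1, Units.val_one, MulOpposite.op_one, one_smul, one_smul] at hprod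
  refine hprod.congr_fderiv ?_
  ext z
  have hcard : (Fintype.card ι : ℂ) ≠ 0 := Nat.cast_ne_zero.2 Fintype.card_ne_zero
  have hmean : (meanCLM ι 𝔸) (fun i => b' i z - v' z) = (Fintype.card ι : ℂ)⁻¹ • (∑ i, b' i z) - v' z := by
    rw [meanCLM_apply, Finset.sum_sub_distrib, smul_sub, Finset.sum_const, Finset.card_univ, ← Nat.cast_smul_eq_nsmul ℂ, smul_smul,
      inv_mul_cancel₀ hcard, one_smul]
  simp [hmean]

end Eml

/-! ## §2 ★★★ The symmetric tower: the derivative recursion of the accumulated frames -/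

section Tower

open B10Eq27TorusAxialLog (holT transl)
open B7Prop1Explicit (disp)
open Summit.QuantumFields.YangMills.Theorems.Prop8Chart (emlIterU differentiableAt_coe_holT differentiableAt_coe_inv)
open Summit.QuantumFields.YangMills.Theorems.Prop7SymAvgTwSym (tstairU vframeCovU coe_vframeCovU dbarCovIterU frameAccU frameAccU_succ frameAccU_zero frameAccU_self
  vframeCovU_self dbarCovIterU_self)
open Summit.QuantumFields.YangMills.Theorems.Prop7AccumulatedFrameStep (tstairU_eq_frame_inv_mul)

variable {P : Params} {𝔸 : Type*} [NormedRing 𝔸] [NormedAlgebra ℂ 𝔸] [CompleteSpace 𝔸]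
variable {E : Type*} [NormedAddCommGroup E] [NormedSpace ℂ E]
variable (V₀ : GaugeField P 0 𝔸ˣ) (W : E → GaugeField P 0 𝔸ˣ) {a : E}

/-- **LEVEL `0`**: `v_0 ≡ 1`, derivative `0`. [cite: Balaban1985Averaging, (97) p.32] -/
theorem hasFDerivAt_coe_frameAccU_zero (x : Site P 0) :
    HasFDerivAt (fun t => (frameAccU 0 V₀ (W t) x : 𝔸)) (0 : E →L[ℂ] 𝔸) a := by
  have heq : (fun t => (frameAccU 0 V₀ (W t) x : 𝔸)) = fun _ => 1 := by
    funext t; rw [frameAccU_zero, Units.val_one]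
  rw [heq]
  exact hasFDerivAt_const _ _

/-- ★★★ **THE DERIVATIVE RECURSION OF THE ACCUMULATED SYMMETRIC FRAMES** ((97) ∘ ✓px22 `tstairU_eq_frame_inv_mul`, differentiated at a base point `W a = V₀` where every frame and
every stair ratio is `1`): if the stair ratios `t ↦ Ū[W t]⁽ᵏ⁾(st_i)·Ū₀⁽ᵏ⁾(st_i)⁻¹` have derivatives `ρ i`, the level-`k` frames at the stair ends `x_i` have `ℓ i` and at the centre
`emb y` has `ℓ₀`, then `t ↦ ↑(v_{k+1}(t)(y))` has derivative `|Idx|⁻¹ Σ_i (ρ i + Ad_{ν_i} ∘ ℓ i)`, `ν_i = Ū₀⁽ᵏ⁾(st_i)` — the centre response `ℓ₀` does not enter.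
[cite: Balaban1985Averaging, (97) p.32, (82) p.30, (58) p.27; Balaban1987RG1, (0.8) p.254] -/
theorem hasFDerivAt_coe_frameAccU_succ (hW : W a = V₀) (k : ℕ) (y : Site P (k + 1))
    {ℓ₀ : E →L[ℂ] 𝔸} {ρ ℓ : Idx P → E →L[ℂ] 𝔸}
    (h0 : HasFDerivAt (fun t => (frameAccU k V₀ (W t) (emb y) : 𝔸)) ℓ₀ a)
    (hρ : ∀ i : Idx P, HasFDerivAt (fun t => ((holT (emlIterU k (W t)) (emb y) (stairWord i.2.1 (off i.1))
        * (holT (emlIterU k V₀) (emb y) (stairWord i.2.1 (off i.1)))⁻¹ : 𝔸ˣ) : 𝔸)) (ρ i) a)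
    (hℓ : ∀ i : Idx P, HasFDerivAt (fun t => (frameAccU k V₀ (W t) (transl (emb y) (disp (stairWord i.2.1 (off i.1)))) : 𝔸)) (ℓ i) a) :
    HasFDerivAt (fun t => (frameAccU (k + 1) V₀ (W t) y : 𝔸))
      ((Fintype.card (Idx P) : ℂ)⁻¹ • ∑ i : Idx P,
        (ρ i + (ContinuousLinearMap.mulLeftRight ℂ 𝔸 ((holT (emlIterU k V₀) (emb y) (stairWord i.2.1 (off i.1)) : 𝔸ˣ) : 𝔸)
          (((holT (emlIterU k V₀) (emb y) (stairWord i.2.1 (off i.1)))⁻¹ : 𝔸ˣ) : 𝔸)).comp (ℓ i))) a := by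
  -- the factors `b_i t := R_i t · a_i t`
  set b : Idx P → E → 𝔸 := fun i t =>
    ((holT (emlIterU k (W t)) (emb y) (stairWord i.2.1 (off i.1)) * (holT (emlIterU k V₀) (emb y) (stairWord i.2.1 (off i.1)))⁻¹ : 𝔸ˣ) : 𝔸)
      * (((holT (emlIterU k V₀) (emb y) (stairWord i.2.1 (off i.1)) : 𝔸ˣ) : 𝔸) * (frameAccU k V₀ (W t) (transl (emb y) (disp (stairWord i.2.1 (off i.1)))) : 𝔸)
        * (((holT (emlIterU k V₀) (emb y) (stairWord i.2.1 (off i.1)))⁻¹ : 𝔸ˣ) : 𝔸)) with hb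
  have heq : (fun t => (frameAccU (k + 1) V₀ (W t) y : 𝔸))
      = fun t => (frameAccU k V₀ (W t) (emb y) : 𝔸) * eml (fun i => (((frameAccU k V₀ (W t) (emb y))⁻¹ : 𝔸ˣ) : 𝔸) * b i t) := by
    funext t
    rw [frameAccU_succ, Units.val_mul, coe_vframeCovU]
    congr 1
    congr 1
    funext i
    rw [tstairU_eq_frame_inv_mul, hb]
    simp only [Units.val_mul, mul_assoc]
  rw [heq]
  -- values at the base point
  have hR1 : ∀ i : Idx P, (holT (emlIterU k (W a)) (emb y) (stairWord i.2.1 (off i.1))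
      * (holT (emlIterU k V₀) (emb y) (stairWord i.2.1 (off i.1)))⁻¹ : 𝔸ˣ) = 1 := fun i => by rw [hW, mul_inv_cancel]
  have hv1 : frameAccU k V₀ (W a) (emb y) = 1 := by rw [hW, frameAccU_self]
  have ha1 : ∀ i : Idx P, (frameAccU k V₀ (W a) (transl (emb y) (disp (stairWord i.2.1 (off i.1)))) : 𝔸) = 1 := fun i => by
    rw [hW, frameAccU_self, Units.val_one]
  have hb1 : ∀ i, b i a = 1 := fun i => by
    simp only [hb, hR1 i, ha1 i, Units.val_one, mul_one, Units.mul_inv]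
  -- derivatives of the factors
  have hb' : ∀ i, HasFDerivAt (b i) (ρ i + (ContinuousLinearMap.mulLeftRight ℂ 𝔸 ((holT (emlIterU k V₀) (emb y) (stairWord i.2.1 (off i.1)) : 𝔸ˣ) : 𝔸)
      (((holT (emlIterU k V₀) (emb y) (stairWord i.2.1 (off i.1)))⁻¹ : 𝔸ˣ) : 𝔸)).comp (ℓ i)) a := by
    intro i
    have ha' := hasFDerivAt_conj (hℓ i) (((holT (emlIterU k V₀) (emb y) (stairWord i.2.1 (off i.1)) : 𝔸ˣ) : 𝔸))
      ((((holT (emlIterU k V₀) (emb y) (stairWord i.2.1 (off i.1)))⁻¹ : 𝔸ˣ) : 𝔸))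
    have hR1' : ((holT (emlIterU k (W a)) (emb y) (stairWord i.2.1 (off i.1))
        * (holT (emlIterU k V₀) (emb y) (stairWord i.2.1 (off i.1)))⁻¹ : 𝔸ˣ) : 𝔸) = 1 := by rw [hR1 i, Units.val_one]
    have ha1' : (((holT (emlIterU k V₀) (emb y) (stairWord i.2.1 (off i.1)) : 𝔸ˣ) : 𝔸) * (frameAccU k V₀ (W a) (transl (emb y) (disp (stairWord i.2.1 (off i.1)))) : 𝔸)
        * (((holT (emlIterU k V₀) (emb y) (stairWord i.2.1 (off i.1)))⁻¹ : 𝔸ˣ) : 𝔸)) = 1 := by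
      rw [ha1 i, mul_one, Units.mul_inv]
    exact hasFDerivAt_mul_of_eq_one (hρ i) ha' hR1' ha1'
  exact hasFDerivAt_mul_eml_inv_mul_of_eq_one h0 hb' hv1 hb1

/-- ★★ **THE ONE-STEP SYMMETRIC FRAME'S RESPONSE** (px13's (i)): `t ↦ ↑(w_k(t)(y)) = ↑(vframeCovU (Ū₀⁽ᵏ⁾) ((U̿·Ū₀)⁽ᵏ⁾(V₀; W t)) y)` takes the value `1` at `a` and has derivative
`|Idx|⁻¹ Σ_i (ρ i + Ad_{ν_i} ∘ ℓ i) − ℓ₀` there ((97): `w_k(y) = v_k(emb y)⁻¹ · v_{k+1}(y)`). [cite: Balaban1985Averaging, (82) p.30, (97) p.32] -/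
theorem hasFDerivAt_coe_vframeCovU_succ (hW : W a = V₀) (k : ℕ) (y : Site P (k + 1))
    {ℓ₀ : E →L[ℂ] 𝔸} {ρ ℓ : Idx P → E →L[ℂ] 𝔸}
    (h0 : HasFDerivAt (fun t => (frameAccU k V₀ (W t) (emb y) : 𝔸)) ℓ₀ a)
    (hρ : ∀ i : Idx P, HasFDerivAt (fun t => ((holT (emlIterU k (W t)) (emb y) (stairWord i.2.1 (off i.1))
        * (holT (emlIterU k V₀) (emb y) (stairWord i.2.1 (off i.1)))⁻¹ : 𝔸ˣ) : 𝔸)) (ρ i) a)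
    (hℓ : ∀ i : Idx P, HasFDerivAt (fun t => (frameAccU k V₀ (W t) (transl (emb y) (disp (stairWord i.2.1 (off i.1)))) : 𝔸)) (ℓ i) a) :
    vframeCovU (emlIterU k V₀) (dbarCovIterU k V₀ (W a)) y = 1 ∧
    HasFDerivAt (fun t => (vframeCovU (emlIterU k V₀) (dbarCovIterU k V₀ (W t)) y : 𝔸))
      ((Fintype.card (Idx P) : ℂ)⁻¹ • ∑ i : Idx P,
        (ρ i + (ContinuousLinearMap.mulLeftRight ℂ 𝔸 ((holT (emlIterU k V₀) (emb y) (stairWord i.2.1 (off i.1)) : 𝔸ˣ) : 𝔸)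
          (((holT (emlIterU k V₀) (emb y) (stairWord i.2.1 (off i.1)))⁻¹ : 𝔸ˣ) : 𝔸)).comp (ℓ i)) - ℓ₀) a := by
  refine ⟨by rw [hW, dbarCovIterU_self, vframeCovU_self], ?_⟩
  have heq : (fun t => (vframeCovU (emlIterU k V₀) (dbarCovIterU k V₀ (W t)) y : 𝔸))
      = fun t => (((frameAccU k V₀ (W t) (emb y))⁻¹ * frameAccU (k + 1) V₀ (W t) y : 𝔸ˣ) : 𝔸) := by
    funext t; rw [frameAccU_succ, inv_mul_cancel_left]
  rw [heq]
  have hv0 : frameAccU k V₀ (W a) (emb y) = 1 := by rw [hW, frameAccU_self]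
  have hv1 : frameAccU (k + 1) V₀ (W a) y = 1 := by rw [hW, frameAccU_self]
  exact hasFDerivAt_coe_inv_mul_of_eq_one h0 (hasFDerivAt_coe_frameAccU_succ V₀ W hW k y h0 hρ hℓ) hv0 hv1

/-- **THE STAIR RATIOS ARE DIFFERENTIABLE AS SOON AS THE PLAIN TOWER'S BONDS ARE** (✓`Prop8Chart.differentiableAt_coe_holT`; the background leg is constant).
[cite: Balaban1985Averaging, (58) p.27] -/
theorem differentiableAt_stairRatio (k : ℕ) (hT : ∀ b : PBond P k, DifferentiableAt ℂ (fun t => (emlIterU k (W t) b : 𝔸)) a)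
    (y : Site P (k + 1)) (i : Idx P) :
    DifferentiableAt ℂ (fun t => ((holT (emlIterU k (W t)) (emb y) (stairWord i.2.1 (off i.1))
        * (holT (emlIterU k V₀) (emb y) (stairWord i.2.1 (off i.1)))⁻¹ : 𝔸ˣ) : 𝔸)) a := by
  have heq : (fun t => ((holT (emlIterU k (W t)) (emb y) (stairWord i.2.1 (off i.1))
        * (holT (emlIterU k V₀) (emb y) (stairWord i.2.1 (off i.1)))⁻¹ : 𝔸ˣ) : 𝔸))
      = fun t => ((holT (emlIterU k (W t)) (emb y) (stairWord i.2.1 (off i.1)) : 𝔸ˣ) : 𝔸)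
          * (((holT (emlIterU k V₀) (emb y) (stairWord i.2.1 (off i.1)))⁻¹ : 𝔸ˣ) : 𝔸) := by
    funext t; rw [Units.val_mul]
  rw [heq]
  exact (differentiableAt_coe_holT (F := fun t => emlIterU k (W t)) hT _ _).mul (differentiableAt_const _)

/-- ★★ **`fderiv` FORM — px13's `ℓ`-RECURSION IS SATISFIED BY `ℓ := fderiv`**: under differentiability of the plain tower's level-`k` bonds and of the level-`k` accumulated frames,
`fderiv ℂ (t ↦ ↑(v_{k+1}(t)(y))) a = |Idx|⁻¹ Σ_i ( fderiv ℂ (t ↦ ↑(R_{k,i}(t))) a + Ad_{ν_i} ∘ fderiv ℂ (t ↦ ↑(v_k(t)(x_i))) a )`.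
[cite: Balaban1985Averaging, (97) p.32, (82) p.30; Balaban1987RG1, (0.8) p.254] -/
theorem fderiv_coe_frameAccU_succ (hW : W a = V₀) (k : ℕ)
    (hT : ∀ b : PBond P k, DifferentiableAt ℂ (fun t => (emlIterU k (W t) b : 𝔸)) a)
    (hF : ∀ x : Site P k, DifferentiableAt ℂ (fun t => (frameAccU k V₀ (W t) x : 𝔸)) a) (y : Site P (k + 1)) :
    fderiv ℂ (fun t => (frameAccU (k + 1) V₀ (W t) y : 𝔸)) a
      = (Fintype.card (Idx P) : ℂ)⁻¹ • ∑ i : Idx P,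
        (fderiv ℂ (fun t => ((holT (emlIterU k (W t)) (emb y) (stairWord i.2.1 (off i.1))
            * (holT (emlIterU k V₀) (emb y) (stairWord i.2.1 (off i.1)))⁻¹ : 𝔸ˣ) : 𝔸)) a
          + (ContinuousLinearMap.mulLeftRight ℂ 𝔸 ((holT (emlIterU k V₀) (emb y) (stairWord i.2.1 (off i.1)) : 𝔸ˣ) : 𝔸)
            (((holT (emlIterU k V₀) (emb y) (stairWord i.2.1 (off i.1)))⁻¹ : 𝔸ˣ) : 𝔸)).comp
              (fderiv ℂ (fun t => (frameAccU k V₀ (W t) (transl (emb y) (disp (stairWord i.2.1 (off i.1)))) : 𝔸)) a)) :=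
  (hasFDerivAt_coe_frameAccU_succ V₀ W hW k y (hF _).hasFDerivAt (fun i => (differentiableAt_stairRatio V₀ W k hT y i).hasFDerivAt)
    (fun _ => (hF _).hasFDerivAt)).fderiv

/-- ★★★ **APPLIED FORM AT A FIXED DIRECTION `A` — px13 g6's `ℓ`-RECURSION TOKEN FOR TOKEN** (`ℓk x := fderiv ℂ (t ↦ ↑(v_k(t)(x))) a A`, `ℓR y i := fderiv ℂ (t ↦ ↑(R_{k,i}(t))) a A`):
`fderiv ℂ (t ↦ ↑(v_{k+1}(t)(y))) a A = |Idx|⁻¹ • Σ_i ( ℓR y i + ν_i · ℓk(x_i) · ν_i⁻¹ )`. [cite: Balaban1985Averaging, (97) p.32, (82) p.30; Balaban1987RG1, (0.8) p.254] -/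
theorem fderiv_coe_frameAccU_succ_apply (hW : W a = V₀) (k : ℕ)
    (hT : ∀ b : PBond P k, DifferentiableAt ℂ (fun t => (emlIterU k (W t) b : 𝔸)) a)
    (hF : ∀ x : Site P k, DifferentiableAt ℂ (fun t => (frameAccU k V₀ (W t) x : 𝔸)) a) (y : Site P (k + 1)) (A : E) :
    fderiv ℂ (fun t => (frameAccU (k + 1) V₀ (W t) y : 𝔸)) a A
      = (Fintype.card (Idx P) : ℂ)⁻¹ • ∑ i : Idx P,
        (fderiv ℂ (fun t => ((holT (emlIterU k (W t)) (emb y) (stairWord i.2.1 (off i.1))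
            * (holT (emlIterU k V₀) (emb y) (stairWord i.2.1 (off i.1)))⁻¹ : 𝔸ˣ) : 𝔸)) a A
          + ((holT (emlIterU k V₀) (emb y) (stairWord i.2.1 (off i.1)) : 𝔸ˣ) : 𝔸)
            * fderiv ℂ (fun t => (frameAccU k V₀ (W t) (transl (emb y) (disp (stairWord i.2.1 (off i.1)))) : 𝔸)) a A
            * (((holT (emlIterU k V₀) (emb y) (stairWord i.2.1 (off i.1)))⁻¹ : 𝔸ˣ) : 𝔸)) := by
  rw [fderiv_coe_frameAccU_succ V₀ W hW k hT hF y]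
  simp only [smul_apply, sum_apply]
  rfl

/-- ★★ **THE ONE-STEP FRAME, APPLIED FORM** (px13's (i) at a fixed direction): `fderiv ℂ (t ↦ ↑(w_k(t)(y))) a A = |Idx|⁻¹ • Σ_i (ℓR y i + ν_i·ℓk(x_i)·ν_i⁻¹) − ℓk(emb y)` and
`w_k(a)(y) = 1`. [cite: Balaban1985Averaging, (82) p.30, (97) p.32] -/
theorem fderiv_coe_vframeCovU_succ_apply (hW : W a = V₀) (k : ℕ)
    (hT : ∀ b : PBond P k, DifferentiableAt ℂ (fun t => (emlIterU k (W t) b : 𝔸)) a)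
    (hF : ∀ x : Site P k, DifferentiableAt ℂ (fun t => (frameAccU k V₀ (W t) x : 𝔸)) a) (y : Site P (k + 1)) (A : E) :
    vframeCovU (emlIterU k V₀) (dbarCovIterU k V₀ (W a)) y = 1 ∧
    fderiv ℂ (fun t => (vframeCovU (emlIterU k V₀) (dbarCovIterU k V₀ (W t)) y : 𝔸)) a A
      = (Fintype.card (Idx P) : ℂ)⁻¹ • ∑ i : Idx P,
        (fderiv ℂ (fun t => ((holT (emlIterU k (W t)) (emb y) (stairWord i.2.1 (off i.1))
            * (holT (emlIterU k V₀) (emb y) (stairWord i.2.1 (off i.1)))⁻¹ : 𝔸ˣ) : 𝔸)) a A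
          + ((holT (emlIterU k V₀) (emb y) (stairWord i.2.1 (off i.1)) : 𝔸ˣ) : 𝔸)
            * fderiv ℂ (fun t => (frameAccU k V₀ (W t) (transl (emb y) (disp (stairWord i.2.1 (off i.1)))) : 𝔸)) a A
            * (((holT (emlIterU k V₀) (emb y) (stairWord i.2.1 (off i.1)))⁻¹ : 𝔸ˣ) : 𝔸))
        - fderiv ℂ (fun t => (frameAccU k V₀ (W t) (emb y) : 𝔸)) a A := by
  have h := hasFDerivAt_coe_vframeCovU_succ V₀ W hW k y (hF _).hasFDerivAt (fun i => (differentiableAt_stairRatio V₀ W k hT y i).hasFDerivAt)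
    (fun _ => (hF _).hasFDerivAt)
  refine ⟨h.1, ?_⟩
  rw [h.2.fderiv]
  simp only [sub_apply, smul_apply, sum_apply]
  rfl

/-- **DIFFERENTIABILITY PROPAGATES UP THE TOWER**: level-`k` bonds of the plain tower and level-`k` frames differentiable ⟹ level-`(k+1)` frames differentiable.
[cite: Balaban1985Averaging, (97) p.32] -/
theorem differentiableAt_coe_frameAccU_succ (hW : W a = V₀) (k : ℕ)
    (hT : ∀ b : PBond P k, DifferentiableAt ℂ (fun t => (emlIterU k (W t) b : 𝔸)) a)
    (hF : ∀ x : Site P k, DifferentiableAt ℂ (fun t => (frameAccU k V₀ (W t) x : 𝔸)) a) (y : Site P (k + 1)) :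
    DifferentiableAt ℂ (fun t => (frameAccU (k + 1) V₀ (W t) y : 𝔸)) a :=
  (hasFDerivAt_coe_frameAccU_succ V₀ W hW k y (hF _).hasFDerivAt (fun i => (differentiableAt_stairRatio V₀ W k hT y i).hasFDerivAt)
    (fun _ => (hF _).hasFDerivAt)).differentiableAt

end Tower

/-! ## §3 The member: the top of the recursion is `fderiv (frameTwS W · y) 0` -/

section Member

open Literature.MathematicalPhysics.QuantumFieldTheory.Balaban1983to89.T3ContinuumYM3Torus
open T3LevelShift (siteShift)
open T3PrintedRegularOrbits (sites_eq)
open T3SectALandauChart (bgUnits)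
open B7Prop1Explicit (expUnit)
open Summit.QuantumFields.YangMills.Theorems.Prop7SymAvgTwSym (frameTwS frameTwS_def frameAccU)
open Summit.QuantumFields.YangMills.Theorems.Prop7SymAvgGL (expUnit_zero_mul_bgUnits)

variable (F : T3Family) {n K : ℕ} (h : n ≤ K)

/-- **THE (β) DOOR'S SYMMETRIC FRAME IS §2's ACCUMULATED FRAME OF THE FAMILY `A ↦ e^{A}·U₀♭`** at level `K − n`, site `siteShift y` (✓`frameTwS_def`, as functions of `A`).
[cite: Balaban1985Averaging, (97) p.32] -/
theorem frameTwS_family_eq (W : GaugeField (F.P K) 0 (Matrix.specialUnitaryGroup (Fin 2) ℂ)) (y : Site (F.P n) 0) :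
    (fun A : PBond (F.P K) 0 → Matrix (Fin 2) (Fin 2) ℂ => ((frameTwS F n K h W A y : (Matrix (Fin 2) (Fin 2) ℂ)ˣ) : Matrix (Fin 2) (Fin 2) ℂ))
      = fun A => ((frameAccU (K - n) (bgUnits F K W) (fun b => expUnit (A b) * bgUnits F K W b) (siteShift (sites_eq F n K h) y) : (Matrix (Fin 2) (Fin 2) ℂ)ˣ) :
          Matrix (Fin 2) (Fin 2) ℂ) := rfl

/-- **THE FAMILY PASSES THROUGH THE BASE POINT**: `e^{0}·U₀♭ = U₀♭` — §2's hypothesis `W a = V₀` at `a = 0`. [cite: Balaban1985Averaging, (8) p.19] -/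
theorem family_zero (W : GaugeField (F.P K) 0 (Matrix.specialUnitaryGroup (Fin 2) ℂ)) :
    (fun b => expUnit ((0 : PBond (F.P K) 0 → Matrix (Fin 2) (Fin 2) ℂ) b) * bgUnits F K W b) = bgUnits F K W :=
  expUnit_zero_mul_bgUnits F K W

/-- ★ **px13's (ii) — THE TOP OF THE RECURSION IS R0-DOOR's LINEAR PART**: `fderiv ℂ (A ↦ ↑(frameTwS F n K h W A y)) 0` IS the derivative at `0` of §2's level-`(K − n)` accumulated
frame of the family `A ↦ e^{A}·U₀♭` at `siteShift y`; so the `k = K − n` instance of a recursion whose linear parts are the `fderiv`s (§2 `fderiv_coe_frameAccU_succ`) lands on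
✓`Prop7R0OfFrameRows.siteRow_of_frameRows`' row `hrs` by `rw`. [cite: Balaban1985Averaging, (97) p.32; Balaban1985BackgroundPropagators, (3.14) p.393] -/
theorem fderiv_frameTwS_eq_fderiv_frameAccU (W : GaugeField (F.P K) 0 (Matrix.specialUnitaryGroup (Fin 2) ℂ)) (y : Site (F.P n) 0) :
    fderiv ℂ (fun A : PBond (F.P K) 0 → Matrix (Fin 2) (Fin 2) ℂ => ((frameTwS F n K h W A y : (Matrix (Fin 2) (Fin 2) ℂ)ˣ) : Matrix (Fin 2) (Fin 2) ℂ)) 0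
      = fderiv ℂ (fun A : PBond (F.P K) 0 → Matrix (Fin 2) (Fin 2) ℂ =>
          ((frameAccU (K - n) (bgUnits F K W) (fun b => expUnit (A b) * bgUnits F K W b) (siteShift (sites_eq F n K h) y) : (Matrix (Fin 2) (Fin 2) ℂ)ˣ) :
            Matrix (Fin 2) (Fin 2) ℂ)) 0 := rfl

/-- the `HasFDerivAt` transfer between the two spellings (any candidate derivative `r`). [cite: Balaban1985Averaging, (97) p.32] -/
theorem hasFDerivAt_frameTwS_iff (W : GaugeField (F.P K) 0 (Matrix.specialUnitaryGroup (Fin 2) ℂ)) (y : Site (F.P n) 0)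
    (r : (PBond (F.P K) 0 → Matrix (Fin 2) (Fin 2) ℂ) →L[ℂ] Matrix (Fin 2) (Fin 2) ℂ) (A₀ : PBond (F.P K) 0 → Matrix (Fin 2) (Fin 2) ℂ) :
    HasFDerivAt (fun A : PBond (F.P K) 0 → Matrix (Fin 2) (Fin 2) ℂ => ((frameTwS F n K h W A y : (Matrix (Fin 2) (Fin 2) ℂ)ˣ) : Matrix (Fin 2) (Fin 2) ℂ)) r A₀ ↔
      HasFDerivAt (fun A : PBond (F.P K) 0 → Matrix (Fin 2) (Fin 2) ℂ =>
          ((frameAccU (K - n) (bgUnits F K W) (fun b => expUnit (A b) * bgUnits F K W b) (siteShift (sites_eq F n K h) y) : (Matrix (Fin 2) (Fin 2) ℂ)ˣ) :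
            Matrix (Fin 2) (Fin 2) ℂ)) r A₀ := Iff.rfl

end Member

end Summit.QuantumFields.YangMills.Theorems.Prop7SymFrameLinearResponseStep

end
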